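/-
Origin: expansion seat `planner-pub-hodgecm-prl1-0`, handover v8 2026-08-18T03:58:20Z / addendum 03:59:26Z (`HOME/pub-hodgecm-prl1/lean/Prl1/HeckeSeesaw.lean`, md5 a8878f14, 147 lines);
landed by the gen-5 packager in gate run 20 as `HodgeCM/Assembly/CorCMHeckeSeesaw.lean` (import ^import Prl1\.HeckeWedge\b→import HodgeCM.Automorphic.HeckeWedge ×1; import ^import Prl1\.SeesawConstructionCopy\b→import HodgeCM.Proofs.SeesawConstruction ×1).
-/
/-
Copyright: pub-hodgecm formalisation cell (harness21, 2026). New file (not vendored).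
Origin: HOME/pub-hodgecm-prl1/lean/Prl1/HeckeSeesaw.lean — session planner-pub-hodgecm-prl1-0 (unit pub-hodgecm-prl1), v8.
Intended final place: `HodgeCM/Assembly/CorCMHeckeSeesaw.lean` (imports `HodgeCM.Proofs.SeesawConstruction` — seat
landherr-g2, run 19 — and `HodgeCM.Automorphic.HeckeWedge`, `HodgeCM.Automorphic.ThetaWedgeSplit`).  Fully proved;
nothing asserted; no new constants.
-/
import Summits.HodgeConjecture.HodgeCM.Proofs.SeesawConstruction_2
import Summits.HodgeConjecture.HodgeCM.Automorphic.HeckeWedge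
import Summits.HodgeConjecture.HodgeCM.Proofs.PohlmannSpan
import Summits.HodgeConjecture.HodgeCM.StubTree.Qw8FaceBridge

/-!
# The Hecke and ball routes WITHOUT `Lemma33bLandherr`

Join of two run-19 refinements of the realisation construction:

* `HodgeCM.Proofs.SeesawConstruction` (seat landherr-g2): the forced-sign seesaw datum of Def 3.2 is CONSTRUCTED
  (`ThetaModel.exists_seesawDatum_constructed (hκ : Design_kappaConj) (hs : Design_frameSignConj)`), so the
  classification input `Lemma33bLandherr` (Landherr / Hasse–Minkowski) is no longer needed;
* `HodgeCM.Proofs.RealisationConstruction.nonempty_thetaRealisation_ofD` (this seat, v8): the construction from a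
  GIVEN seesaw datum with A6 only at the given `(L, ι₁, V)` — the form the Hecke route needs (`[L:ℚ] ≥ 4`).

Headlines (hypotheses: `ModelAxioms`; `HeckeInputs` = Venkataramana 2001 Thm 8 + N33b + transfer + definitional,
or the ball dictionary `BallInputs`; `Open_supply`; the inputs of `ThetaModel.Inputs` except A6; `Fact_hodgeRiemann20`
— and NOTHING ELSE: `LevelDirected` and `Lemma33bLandherr` are both discharged):
`realisationExistsPerL_of_hecke''`, `realisationExistsFace_of_hecke''`, `Assembly.COR_CM_hecke''` (+ `PohlmannSpan`,
`Qw8Sufficiency`), `Assembly.perL_hecke''`; ball route `Assembly.COR_CM_ball''`, `Assembly.perL_ball''` (one-liners over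
landherr-g2's `COR_CM_theta''` / `perL_theta''` and `Inputs.of_ball`); and the END-STATE forms `Assembly.COR_CM_endState_hecke`,
`Assembly.COR_CM_endState_ball` (as landherr-g2's `COR_CM_endState`, `HodgeCM/Assembly/CorCMEndState.lean`: Pohlmann from
`Fact_weightSpan` + `Fact_weightHodge` via `pohlmannSpan_holds`, Qw8 from `Qw8ExtProd` + `Qw8DualPushPull` + `Qw8Milne` via
`qw8Sufficiency_of_modelAxioms`).
-/

noncomputable section

namespace HodgeCM

namespace Universe

namespace ThetaModel

variable {U : Universe} {T : U.ThetaModel} {Hk : U.HeckeData}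

/-- **`RealisationExistsPerL` by the Hecke route, no Landherr**: `[L:ℚ] ∈ {24, 48} ≥ 4`. -/
theorem realisationExistsPerL_of_hecke'' (M : U.ModelAxioms) (hH : T.HeckeInputs Hk) (hS : T.Open_supply)
    (h₁ : T.Fact_embCover) (h₂ : T.Fact_innerEmb)
    (h₃ : T.Design_kappaConj) (h₄ : T.Design_frameSignConj) (h₅ : T.Open_thetaSub) (h₇ : T.Open_thetaGen12)
    (h₈ : T.Open_thetaReal34) (h₉ : T.Open_chars) (h₁₀ : T.Open_occ)
    (hHR : U.Fact_hodgeRiemann20) : U.RealisationExistsPerL := by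
  intro K L j _ hK hL24 φ hφ ι₁ hι₁ t ht V
  have hmem : ∀ i, φ 0 ∈ (t i).1 := fun i => (ht i 0).mpr (by fin_cases i <;> rfl)
  have hL4 : 4 ≤ Module.finrank ℚ L := by rcases hL24 with h | h <;> omega
  have hΨ : PairSum t := StubTree.pairSum_of_isPerLTypes K φ hφ hK t ht
  obtain ⟨D, hD⟩ := T.exists_seesawDatum_constructed h₃ h₄ j ι₁ t hΨ
  exact T.nonempty_thetaRealisation_ofD M h₁ h₂ h₅ h₇ h₈ h₉ h₁₀ hHR levelDirected j ι₁ t (φ 0) hι₁ hΨ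
    (StubTree.injective_of_isPerLTypes K φ hφ t ht) hmem V D hD (T.thetaWedge_of_hecke hH hS hL4 V)

/-- **`RealisationExistsFace` by the Hecke route, no Landherr** (`[F:ℚ] ≥ 6 ≥ 4`). -/
theorem realisationExistsFace_of_hecke'' (M : U.ModelAxioms) (hH : T.HeckeInputs Hk) (hS : T.Open_supply)
    (h₁ : T.Fact_embCover) (h₂ : T.Fact_innerEmb)
    (h₃ : T.Design_kappaConj) (h₄ : T.Design_frameSignConj) (h₅ : T.Open_thetaSub) (h₇ : T.Open_thetaGen12)
    (h₈ : T.Open_thetaReal34) (h₉ : T.Open_chars) (h₁₀ : T.Open_occ)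
    (hHR : U.Fact_hodgeRiemann20) : U.RealisationExistsFace := by
  intro E _ hE f ι₁ hadm V
  have hE4 : 4 ≤ Module.finrank ℚ E := le_trans (by norm_num) hE
  obtain ⟨D, hD⟩ := T.exists_seesawDatum_constructed h₃ h₄ (RingHom.id E) ι₁ f.psi (pairSum_psi f)
  exact T.nonempty_thetaRealisation_ofD M h₁ h₂ h₅ h₇ h₈ h₉ h₁₀ hHR levelDirected (RingHom.id E) ι₁ f.psi ι₁
    (RingHom.comp_id ι₁) (pairSum_psi f) (StubTree.psi_injective E f) (admissible_mem_psi f ι₁ hadm) V D hD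
    (T.thetaWedge_of_hecke hH hS hE4 V)

end ThetaModel

end Universe

namespace Assembly

open Universe

/-- **COR-CM by the Hecke route, no Landherr**: `HC_CM` from `ModelAxioms`, `HeckeInputs` (Venkataramana 2001
Thm 8 + N33b), `Open_supply`, the theta model's inputs except A6, `Fact_hodgeRiemann20`, `PohlmannSpan`,
`Qw8Sufficiency`. -/
theorem COR_CM_hecke'' (U : Universe) (M : U.ModelAxioms) (T : U.ThetaModel) {Hk : U.HeckeData}
    (hH : T.HeckeInputs Hk) (hS : T.Open_supply) (h₁ : T.Fact_embCover) (h₂ : T.Fact_innerEmb)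
    (h₃ : T.Design_kappaConj) (h₄ : T.Design_frameSignConj) (h₅ : T.Open_thetaSub) (h₇ : T.Open_thetaGen12)
    (h₈ : T.Open_thetaReal34) (h₉ : T.Open_chars) (h₁₀ : T.Open_occ)
    (hHR : U.Fact_hodgeRiemann20) (hP : U.PohlmannSpan) (hQ : U.Qw8Sufficiency) : U.HC_CM :=
  COR_CM U M (T.realisationExistsFace_of_hecke'' M hH hS h₁ h₂ h₃ h₄ h₅ h₇ h₈ h₉ h₁₀ hHR) hP hQ

/-- **PerL by the Hecke route, no Landherr.** -/
theorem perL_hecke'' (U : Universe) (M : U.ModelAxioms) (T : U.ThetaModel) {Hk : U.HeckeData}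
    (hH : T.HeckeInputs Hk) (hS : T.Open_supply) (h₁ : T.Fact_embCover) (h₂ : T.Fact_innerEmb)
    (h₃ : T.Design_kappaConj) (h₄ : T.Design_frameSignConj) (h₅ : T.Open_thetaSub) (h₇ : T.Open_thetaGen12)
    (h₈ : T.Open_thetaReal34) (h₉ : T.Open_chars) (h₁₀ : T.Open_occ)
    (hHR : U.Fact_hodgeRiemann20) : U.PerL :=
  perL U M (T.realisationExistsPerL_of_hecke'' M hH hS h₁ h₂ h₃ h₄ h₅ h₇ h₈ h₉ h₁₀ hHR)

/-- **COR-CM by the ball route, no Landherr** (landherr-g2's `COR_CM_theta''` on `Inputs.of_ball`). -/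
theorem COR_CM_ball'' (U : Universe) (M : U.ModelAxioms) (T : U.ThetaModel)
    (B : ∀ {L : CMField} {ι₁ : L →+* ℂ} (V : HermSpace3 L ι₁) (c : SeesawCtx L), U.BallData V c)
    (hB : T.BallInputs B) (hS : T.Open_supply) (h₁ : T.Fact_embCover) (h₂ : T.Fact_innerEmb)
    (h₃ : T.Design_kappaConj) (h₄ : T.Design_frameSignConj) (h₅ : T.Open_thetaSub) (h₇ : T.Open_thetaGen12)
    (h₈ : T.Open_thetaReal34) (h₉ : T.Open_chars) (h₁₀ : T.Open_occ)
    (hHR : U.Fact_hodgeRiemann20) (hP : U.PohlmannSpan) (hQ : U.Qw8Sufficiency) : U.HC_CM :=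
  COR_CM_theta'' U M T (ThetaModel.Inputs.of_ball T B hB hS h₁ h₂ h₃ h₄ h₅ h₇ h₈ h₉ h₁₀) hHR hP hQ

/-- **PerL by the ball route, no Landherr.** -/
theorem perL_ball'' (U : Universe) (M : U.ModelAxioms) (T : U.ThetaModel)
    (B : ∀ {L : CMField} {ι₁ : L →+* ℂ} (V : HermSpace3 L ι₁) (c : SeesawCtx L), U.BallData V c)
    (hB : T.BallInputs B) (hS : T.Open_supply) (h₁ : T.Fact_embCover) (h₂ : T.Fact_innerEmb)
    (h₃ : T.Design_kappaConj) (h₄ : T.Design_frameSignConj) (h₅ : T.Open_thetaSub) (h₇ : T.Open_thetaGen12)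
    (h₈ : T.Open_thetaReal34) (h₉ : T.Open_chars) (h₁₀ : T.Open_occ)
    (hHR : U.Fact_hodgeRiemann20) : U.PerL :=
  perL_theta'' U M T (ThetaModel.Inputs.of_ball T B hB hS h₁ h₂ h₃ h₄ h₅ h₇ h₈ h₉ h₁₀) hHR

/-- **END STATE, Hecke route**: `HC_CM` from the 28 model facts, M29/M30 (`Fact_weightSpan`, `Fact_weightHodge`), the
three [QW8] facts (`Qw8ExtProd`, `Qw8DualPushPull`, `Qw8Milne`), a theta model with Hecke data satisfying `HeckeInputs`
(Venkataramana 2001 Thm 8 · N33b · transfer · definitional), `Open_supply`, the eight non-A6 theta inputs and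
`Fact_hodgeRiemann20` — no `LevelDirected`, no `Lemma33bLandherr`, no `PohlmannSpan`/`Qw8Sufficiency` hypotheses. -/
theorem COR_CM_endState_hecke (U : Universe) (M : U.ModelAxioms) (h29 : U.Fact_weightSpan)
    (h30 : U.Fact_weightHodge) (hE : U.Qw8ExtProd) (hD : U.Qw8DualPushPull) (hMi : U.Qw8Milne)
    (T : U.ThetaModel) {Hk : U.HeckeData} (hH : T.HeckeInputs Hk) (hS : T.Open_supply)
    (h₁ : T.Fact_embCover) (h₂ : T.Fact_innerEmb) (h₃ : T.Design_kappaConj) (h₄ : T.Design_frameSignConj)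
    (h₅ : T.Open_thetaSub) (h₇ : T.Open_thetaGen12) (h₈ : T.Open_thetaReal34) (h₉ : T.Open_chars)
    (h₁₀ : T.Open_occ) (hHR : U.Fact_hodgeRiemann20) : U.HC_CM :=
  COR_CM_hecke'' U M T hH hS h₁ h₂ h₃ h₄ h₅ h₇ h₈ h₉ h₁₀ hHR (Universe.pohlmannSpan_holds M h29 h30)
    (Universe.qw8Sufficiency_of_modelAxioms M hE hD hMi)

/-- **END STATE, ball route** (as `COR_CM_endState_hecke`, with the uniformisation dictionary `BallInputs` in place of
the Hecke inputs; no degree guard is involved). -/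
theorem COR_CM_endState_ball (U : Universe) (M : U.ModelAxioms) (h29 : U.Fact_weightSpan)
    (h30 : U.Fact_weightHodge) (hE : U.Qw8ExtProd) (hD : U.Qw8DualPushPull) (hMi : U.Qw8Milne)
    (T : U.ThetaModel)
    (B : ∀ {L : CMField} {ι₁ : L →+* ℂ} (V : HermSpace3 L ι₁) (c : SeesawCtx L), U.BallData V c)
    (hB : T.BallInputs B) (hS : T.Open_supply)
    (h₁ : T.Fact_embCover) (h₂ : T.Fact_innerEmb) (h₃ : T.Design_kappaConj) (h₄ : T.Design_frameSignConj)
    (h₅ : T.Open_thetaSub) (h₇ : T.Open_thetaGen12) (h₈ : T.Open_thetaReal34) (h₉ : T.Open_chars)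
    (h₁₀ : T.Open_occ) (hHR : U.Fact_hodgeRiemann20) : U.HC_CM :=
  COR_CM_ball'' U M T B hB hS h₁ h₂ h₃ h₄ h₅ h₇ h₈ h₉ h₁₀ hHR (Universe.pohlmannSpan_holds M h29 h30)
    (Universe.qw8Sufficiency_of_modelAxioms M hE hD hMi)

end Assembly


end HodgeCM

end
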